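import Summits.HodgeConjecture.HodgeConjecture.Theorems.LinearSystemTorelliLocalTubeSpanLocalKernelOfBalls
import Summits.HodgeConjecture.HodgeConjecture.Theorems.LinearSystemTorelliLocalTubeSpanLocalSubgroupConj
import Summits.HodgeConjecture.HodgeConjecture.Theorems.LinearSystemTorelliLocalTubeSpanConj
import Literature.AlgebraicGeometry.HodgeTheory.LocalKernelConnected

/-!
# Route LinearSystemTorelli — crux `LocalTubeSpan` (stmt-HodgeConjecture-2490): faithfulness of the surrogate under stabilisation of the local subgroups

Helper file (`--supports stmt-HodgeConjecture-2490`, line `Sketch` of the crux chain, cycle 6, stub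
`stub_stableLocalGroup`: "faithfulness of the surrogate under stabilisation of the local
subgroups").

The crux ("local Schnell theorem", C. Schnell, *Primitive cohomology and the tube mapping*,
Math. Z. 268 (2010) = arXiv:0711.3927, §3, §7, §9) is typed in two ways against the tree's
`LocallyTrivialExtensionClasses` / `LocalKernelConnected` (continuous `ι : S → T`, local system `V`
of `k`-modules on `S`, base point `s`, monodromy representation `A = monodromyRepObj V s` of
`G = π₁(S, s)`):

* the COLIMIT form at a point `t₀ ∈ T` (`LocalTubeSpanCFree`, the LEFT side below): a class
  `ξ ∈ H¹(G, A)` undetected by Schnell's third map `evalCoinvOn A _` on the local subgroups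
  `localSubgroup ι s N hs' γ` of SOME neighbourhood `N` of `t₀` (all view points `s'`, all paths
  `γ`) lies in the tree's local kernel `localKernel ι V s t₀` — the kernel of
  `H¹(S, 𝕍) → colim_{U ∋ t₀} H¹(U ∩ S, 𝕍)` of P. Brosnan, H. Fang, Z. Nie, G. Pearlstein,
  *Singularities of admissible normal functions*, Invent. Math. 177 (2009), §1 eq. (1);
* the line's ALGEBRAIC SURROGATE at one subgroup `S₀ ≤ G` (the RIGHT side):
  `ker (evalCoinvOn A S₀) = H1resKer A S₀` — a class undetected by every single element of `S₀`
  restricts to zero on `S₀`.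

`localTubeSpan_stableLocalGroup` — the registered stub: under MILNOR-TYPE STABILISATION at `t₀`
(along a neighbourhood basis `(b i)_{p i}` of `t₀` the punctured basic sets `ι⁻¹ (b i)` are path
connected and one local subgroup per basic set EQUALS the fixed subgroup `S₀` — the local
fundamental groups of small balls coincide in `π₁(S, s)`, Milnor's conic structure), the two forms
are EQUIVALENT.  So on the geometric side the whole line (which proves the surrogate at local
fundamental groups) is faithful to the crux, neither weaker nor stronger.

Proof.  (←) Given the surrogate at `S₀` and `ξ` undetected on the local subgroups of some
`N ∈ 𝓝 t₀`: pick a basic `b i ⊆ N` (`HasBasis.mem_iff`) and its distinguished view point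
`(s', γ)` with `localSubgroup ι s (b i) hs' γ = S₀`; `ξ` is undetected on `S₀` by monotonicity
(`localSubgroup_mono`, `localTubeSpan_evalCoinvOn_eq_zero_of_le`), so by the surrogate
`ξ ∈ H1resKer A S₀ = localKernelOn ι V s (b i)` (`localKernelOn_eq_H1resKer`, one view point
suffices on a path-connected piece), whence `ξ ∈ localKernel ι V s t₀`
(`mem_localKernel_iff_of_hasBasis`).  (→) Given the colimit form, only
`ker (evalCoinvOn A S₀) ≤ H1resKer A S₀` needs proof (`H1resKer_le_ker_evalCoinvOn`): if
`evalCoinvOn A S₀ ξ = 0`, pick any basic `b i₀` (`HasBasis.ex_mem`) with its view point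
`(s₁, γ₁)`, `localSubgroup ι s (b i₀) hs₁ γ₁ = S₀`; every other local subgroup at `b i₀` is a
conjugate `h S₀ h⁻¹` (`localTubeSpan_localSubgroup_conj_of_joinedIn`, `IsPathConnected.joinedIn`)
and the kernel of the third map is conjugation invariant (`localTubeSpan_ker_evalCoinvOn_conj_smul`),
so `ξ` is undetected on all of them and the colimit form gives `ξ ∈ localKernel ι V s t₀`; then
`ξ ∈ localKernelOn ι V s (b i₁)` for some basic `b i₁` (`mem_localKernel_iff_of_hasBasis`), which is
`H1resKer A (localSubgroup ι s (b i₁) hs₃ γ₃) = H1resKer A S₀` by stabilisation again.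

Pure bookkeeping over the tree's definitions (arbitrary commutative ring `k`); no named facts, no
`sorry`.

References: [Schnell2010] C. Schnell, Primitive cohomology and the tube mapping, Math. Z. 268
(2010), §3 (the third map), §9 (local fundamental groups); [BrosnanFangNiePearlstein2009]
P. Brosnan, H. Fang, Z. Nie, G. Pearlstein, Singularities of admissible normal functions, Invent.
Math. 177 (2009), §1 eq. (1); [HatcherAT2002] A. Hatcher, Algebraic Topology (2002), §1.1
Prop. 1.5 (change of base point is conjugation).
-/

-- `Summit.HodgeConjecture.HodgeConjecture.Theorems` is the mandated namespace (single-conjunct summit: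
-- Sub = Summit), which `linter.dupNamespace` flags on every declaration; the lakefile turns the
-- linter off tree-wide (weak option), restated here so stand-alone elaboration is warning-free too.
set_option linter.dupNamespace false

noncomputable section

open _root_.Topology Filter
open Literature.AlgebraicGeometry Literature.AlgebraicGeometry.HodgeTheory
open CategoryTheory groupCohomology
open scoped Pointwise

namespace Summit.HodgeConjecture.HodgeConjecture.Theorems

universe u v

/-! ### The colimit form at `t₀` versus the surrogate at a stable local subgroup -/

/-- **Faithfulness of the surrogate under stabilisation of the local subgroups.** Let
`(b i)_{p i}` be a basis of `𝓝 t₀` such that every punctured basic set `ι⁻¹ (b i)` is path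
connected and carries a view point `(s', γ)` whose local subgroup `localSubgroup ι s (b i) hs' γ`
EQUALS the fixed subgroup `S₀ ≤ π₁(S, s)` (Milnor-type stabilisation of the local fundamental
groups at `t₀`).  Then the c-free local Schnell statement at `t₀` in colimit form — every class of
`H¹(π₁(S, s), V_s)` undetected by Schnell's third map on the local subgroups of some neighbourhood
of `t₀` lies in the local kernel `localKernel ι V s t₀`, the kernel of
`H¹(S, 𝕍) → colim_{U ∋ t₀} H¹(U ∩ S, 𝕍)` of loc. cit. — holds IF AND ONLY IF the algebraic
surrogate `ker (evalCoinvOn A S₀) = H1resKer A S₀` holds at `S₀` (for `A = monodromyRepObj V s`).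
(←): shrink to a basic set, pass to `S₀` by monotonicity of undetectedness, apply the surrogate and
`localKernelOn_eq_H1resKer`; (→): all local subgroups of one basic set are conjugate to `S₀`, the
kernel of the third map is conjugation invariant, so the colimit form applies, and the resulting
basic local kernel is `H1resKer A S₀` by stabilisation. [cite: BrosnanFangNiePearlstein2009, §1 eq. (1)] -/
theorem localTubeSpan_stableLocalGroup {k S : Type u} [CommRing k] [TopologicalSpace S]
    {T : Type v} [TopologicalSpace T]
    (ι : C(S, T)) (V : Literature.AlgebraicGeometry.Motives.LocalSystem k S) (s : S)
    {ι' : Sort*} {p : ι' → Prop} {b : ι' → Set T} {t₀ : T}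
    (hb : (𝓝 t₀).HasBasis p b) (S₀ : Subgroup (FundamentalGroup S s))
    (hstable : ∀ i, p i → IsPathConnected (ι ⁻¹' b i) ∧
      ∃ (s' : S) (hs' : ι s' ∈ b i) (γ : Path s' s), localSubgroup ι s (b i) hs' γ = S₀) :
    (∀ ξ : groupCohomology.H1 (monodromyRepObj V s),
      (∃ N ∈ 𝓝 t₀, ∀ (s' : S) (hs' : ι s' ∈ N) (γ : Path s' s),
        evalCoinvOn (monodromyRepObj V s) (localSubgroup ι s N hs' γ) ξ = 0) →
      ξ ∈ localKernel ι V s t₀) ↔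
    LinearMap.ker (evalCoinvOn (monodromyRepObj V s) S₀) = H1resKer (monodromyRepObj V s) S₀ := by
  constructor
  · -- (→): the colimit form at `t₀` gives the surrogate at `S₀`
    intro hcfree
    refine le_antisymm (fun ξ hξ => ?_) (H1resKer_le_ker_evalCoinvOn _ S₀)
    obtain ⟨i₀, hi₀⟩ := hb.ex_mem
    obtain ⟨hpc₀, s₁, hs₁, γ₁, hS₁⟩ := hstable i₀ hi₀
    -- the hypothesis of the colimit form holds with `N = b i₀`: every local subgroup at `b i₀`
    -- is conjugate to `S₀`, and the kernel of the third map is conjugation invariant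
    have hmem : ξ ∈ localKernel ι V s t₀ := by
      refine hcfree ξ ⟨b i₀, hb.mem_of_mem hi₀, fun s₂ hs₂ γ₂ => LinearMap.mem_ker.1 ?_⟩
      obtain ⟨h, hh⟩ := localTubeSpan_localSubgroup_conj_of_joinedIn ι s (b i₀) hs₂ hs₁
        (hpc₀.joinedIn s₂ hs₂ s₁ hs₁) γ₂ γ₁
      rwa [hh, hS₁, localTubeSpan_ker_evalCoinvOn_conj_smul]
    obtain ⟨i₁, hi₁, hξ₁⟩ := (mem_localKernel_iff_of_hasBasis ι s V hb ξ).1 hmem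
    obtain ⟨hpc₁, s₃, hs₃, γ₃, hS₃⟩ := hstable i₁ hi₁
    rwa [localKernelOn_eq_H1resKer ι s V hpc₁ hs₃ γ₃, hS₃] at hξ₁
  · -- (←): the surrogate at `S₀` gives the colimit form at `t₀`
    rintro hsur ξ ⟨N, hN, hzero⟩
    obtain ⟨i, hi, hiN⟩ := hb.mem_iff.1 hN
    obtain ⟨hpc, s', hs', γ, hS'⟩ := hstable i hi
    -- undetected on the distinguished local subgroup of `b i ⊆ N`, i.e. on `S₀`
    have h0 : evalCoinvOn (monodromyRepObj V s) S₀ ξ = 0 := by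
      have h := localTubeSpan_evalCoinvOn_eq_zero_of_le (monodromyRepObj V s)
        (localSubgroup_mono ι s hiN hs' γ) (hzero s' (hiN hs') γ)
      rwa [hS'] at h
    have hker : ξ ∈ H1resKer (monodromyRepObj V s) S₀ := by
      rw [← hsur]
      exact LinearMap.mem_ker.2 h0
    refine (mem_localKernel_iff_of_hasBasis ι s V hb ξ).2 ⟨i, hi, ?_⟩
    rw [localKernelOn_eq_H1resKer ι s V hpc hs' γ, hS']
    exact hker

end Summit.HodgeConjecture.HodgeConjecture.Theorems

end
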